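import Literature.Probability.LatticeModels.IsingFKG
import Literature.Barriers.CriticalPhenomena.PositionSpaceRGNonGibbsianIsraelFields
import HarnessLib

/-!
# Israel's example (van Enter–Fernández–Sokal 1993, §4.1.2): the FKG comparison of Step 2 with the
# reduced system

Companion file of `PositionSpaceRGNonGibbsianIsraelGeometry.lean`. Step 2 of §4.1.2 lowers the
effective fields of the internal-spin system to those of the reduced system of Figure 4(c) "by the
FKG inequality [126] (or alternatively the Griffiths II inequality [341])": expectations of
nondecreasing observables decrease, of nonincreasing observables increase. Here this is proved for
the internal-spin systems with admissible boundary conditions (`IsAdmissibleBC n ε ζ`: image spins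
`ε ω'_alt` on `Λ_{2n}`, `+` on the annulus, arbitrary outside; volume `W'_n = internalVolume n`,
nearest-neighbour Ising model on `ℤ²`, zero field) against the reduced system
`isingMeasure (cutGraph n) (internalVolume n) β 0 .plus` (no field inside, `+J` on the internal
spins of layer `Γ_{2n+2}`), in the manner of Friedli–Velenik's proof of Lemma 3.23 / Exercise
3.13 (the tree's `IsingBoundaryMonotonicity`): the weights of the admissible system are those of
the reduced one tilted by the nondecreasing factor `exp(β ∑_y c_y σ_y)`, `c_y ≥ 0` the surplus
field (`frozenField_box_le_frozenField`), and the FKG inequality of the reduced system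
(`ising_fkg_holds (cutGraph n)`) does the rest.

## What is formalised (namespace `Literature.Barriers.CriticalPhenomena.NonGibbs`)

`isingExpect_le_of_weight_eq_mul` / `isingExpect_ge_of_weight_eq_mul` (cross-system FKG comparison
from a monotone tilt, any two graphs and boundary conditions on the same volume), `surplusField`,
`israelTilt` and the weight identity `isingWeight_admissible_eq_mul_tilt`, and the comparison
theorems `isingExpect_cut_le_admissible` (nondecreasing local observables) and
`isingExpect_admissible_le_cut` (nonincreasing ones). All proved; no named facts.
-/

noncomputable section

namespace Literature.Barriers.CriticalPhenomena.NonGibbs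

open MeasureTheory Finset Literature.Probability.LatticeModels Literature.Probability.LatticeModels.AEdge

/-! ### Cross-system FKG comparison from a monotone tilt -/

section Tilt

variable {V : Type*} [DecidableEq V] (G₁ G₂ : SimpleGraph V) [G₁.LocallyFinite] [G₂.LocallyFinite]

/-- **FKG comparison of two finite-volume systems on the same volume through a monotone tilt**
(the mechanism of Friedli–Velenik's proof of Lemma 3.23 / Exercise 3.13, here between two graphs
and two boundary conditions): if the Boltzmann weights satisfy `w₂(τ) = w₁(τ) R(τ·bc₁)` with `R`
measurable and nondecreasing, then for every nondecreasing measurable observable `f`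
reading only the spins in `Λ`, `⟨f⟩₁ ≤ ⟨f⟩₂` (`β ≥ 0`): `⟨f⟩₂ = ⟨fR⟩₁/⟨R⟩₁ ≥ ⟨f⟩₁` by the FKG
inequality of system 1. This is the comparison "by the FKG inequality" of van Enter–Fernández–Sokal
§4.1.2 Step 2 between the internal-spin system and the system with lowered fields.
[cite: FriedliVelenik2017, Lemma 3.23 and Exercise 3.13] [cite: VanenterFernandezSokal1993, §4.1.2 Step 2] -/
theorem isingExpect_le_of_weight_eq_mul {β : ℝ} (hβ : 0 ≤ β) (Λ : Finset V) (h₁ h₂ : ℝ)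
    (bc₁ bc₂ : BoundaryCondition V) {R : SpinConfig V → ℝ} (hRm : Measurable R)
    (hRmono : Monotone R)
    (hw : ∀ τ : Λ → ℤˣ, isingWeight G₂ Λ β h₂ bc₂ τ =
      isingWeight G₁ Λ β h₁ bc₁ τ * R (glue Λ τ bc₁))
    {f : SpinConfig V → ℝ} (hf : Monotone f) (hfm : Measurable f)
    (hfΛ : ∀ σ σ' : SpinConfig V, (∀ x ∈ Λ, σ x = σ' x) → f σ = f σ') :
    isingExpect G₁ Λ β h₁ bc₁ f ≤ isingExpect G₂ Λ β h₂ bc₂ f := by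
  have hZ₁ := isingPartitionFunction_pos G₁ Λ β h₁ bc₁
  have hZ₂ := isingPartitionFunction_pos G₂ Λ β h₂ bc₂
  have hglue : ∀ τ : Λ → ℤˣ, f (glue Λ τ bc₂) = f (glue Λ τ bc₁) := fun τ =>
    hfΛ _ _ fun x hx => by rw [glue_apply_of_mem _ _ _ hx, glue_apply_of_mem _ _ _ hx]
  -- `⟨f⟩₂ = ⟨fR⟩₁ / ⟨R⟩₁`
  have hfR : isingExpect G₁ Λ β h₁ bc₁ (fun σ => f σ * R σ) =
      (∑ τ : Λ → ℤˣ, isingWeight G₂ Λ β h₂ bc₂ τ * f (glue Λ τ bc₂)) /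
        isingPartitionFunction G₁ Λ β h₁ bc₁ := by
    rw [isingExpect_eq_sum_div G₁ Λ h₁ bc₁ β (f := fun σ => f σ * R σ) (hfm.mul hRm)]
    congr 1
    refine Finset.sum_congr rfl fun τ _ => ?_
    rw [hw τ, hglue τ]
    ring
  have hRexp : isingExpect G₁ Λ β h₁ bc₁ R =
      isingPartitionFunction G₂ Λ β h₂ bc₂ / isingPartitionFunction G₁ Λ β h₁ bc₁ := by
    rw [isingExpect_eq_sum_div G₁ Λ h₁ bc₁ β hRm]
    congr 1
    simp only [isingPartitionFunction]
    exact Finset.sum_congr rfl fun τ _ => by rw [hw τ]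
  have hRexp_pos : 0 < isingExpect G₁ Λ β h₁ bc₁ R := by rw [hRexp]; exact div_pos hZ₂ hZ₁
  have h2 : isingExpect G₂ Λ β h₂ bc₂ f =
      isingExpect G₁ Λ β h₁ bc₁ (fun σ => f σ * R σ) / isingExpect G₁ Λ β h₁ bc₁ R := by
    rw [hfR, hRexp, div_div_div_cancel_right₀ hZ₁.ne', isingExpect_eq_sum_div G₂ Λ h₂ bc₂ β hfm]
  rw [h2, le_div_iff₀ hRexp_pos]
  exact ising_fkg_holds G₁ hβ Λ h₁ bc₁ f R hf hRmono hfm hRm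

/-- The mirror image for NONINCREASING observables: `⟨f⟩₂ ≤ ⟨f⟩₁` (apply the previous lemma to
`-f`). [cite: FriedliVelenik2017, Lemma 3.23 and Exercise 3.13] [cite: VanenterFernandezSokal1993, §4.1.2 Step 2] -/
theorem isingExpect_ge_of_weight_eq_mul {β : ℝ} (hβ : 0 ≤ β) (Λ : Finset V) (h₁ h₂ : ℝ)
    (bc₁ bc₂ : BoundaryCondition V) {R : SpinConfig V → ℝ} (hRm : Measurable R)
    (hRmono : Monotone R)
    (hw : ∀ τ : Λ → ℤˣ, isingWeight G₂ Λ β h₂ bc₂ τ =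
      isingWeight G₁ Λ β h₁ bc₁ τ * R (glue Λ τ bc₁))
    {f : SpinConfig V → ℝ} (hf : Antitone f) (hfm : Measurable f)
    (hfΛ : ∀ σ σ' : SpinConfig V, (∀ x ∈ Λ, σ x = σ' x) → f σ = f σ') :
    isingExpect G₂ Λ β h₂ bc₂ f ≤ isingExpect G₁ Λ β h₁ bc₁ f := by
  have key := isingExpect_le_of_weight_eq_mul G₁ G₂ hβ Λ h₁ h₂ bc₁ bc₂ hRm hRmono hw
    (f := fun σ => -f σ) (fun σ σ' hle => neg_le_neg (hf hle)) hfm.neg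
    (fun σ σ' hσ => by rw [hfΛ σ σ' hσ])
  have hneg : ∀ (G : SimpleGraph V) [G.LocallyFinite] (h : ℝ) (bc : BoundaryCondition V),
      isingExpect G Λ β h bc (fun σ => -f σ) = -isingExpect G Λ β h bc f := fun G _ h bc => by
    unfold isingExpect
    exact integral_neg f
  rw [hneg, hneg] at key
  exact neg_le_neg_iff.1 key

end Tilt

/-! ### The tilt between an admissible internal-spin system and the reduced system -/

/-- The effective field depends on `g` only off `P`. [cite: VanenterFernandezSokal1993, §4.1.2 Step 2] -/
theorem frozenField_congr_fun {P : Site 2 → Prop} [DecidablePred P] {g g' : Site 2 → ℝ}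
    (h : ∀ z, ¬ P z → g z = g' z) (y : Site 2) : frozenField P g y = frozenField P g' y := by
  unfold frozenField
  refine Finset.sum_congr rfl fun i _ => ?_
  congr 1
  · by_cases hp : P (y + vec i)
    · rw [if_pos hp, if_pos hp]
    · rw [if_neg hp, if_neg hp, h _ hp]
  · by_cases hp : P (y - vec i)
    · rw [if_pos hp, if_pos hp]
    · rw [if_neg hp, if_neg hp, h _ hp]

/-- Bonds inside `Λ` read only the spins in `Λ`. [cite: VanenterFernandezSokal1993, §4.1.2 Step 2] -/
theorem sum_anch_bE_congr (Λ : Finset (Site 2)) {σ σ' : SpinConfig (Site 2)}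
    (h : ∀ x ∈ Λ, σ x = σ' x) : ∑ ε ∈ anch Λ, bE ε σ = ∑ ε ∈ anch Λ, bE ε σ' := by
  refine Finset.sum_congr rfl fun ε hε => ?_
  rw [mem_anch] at hε
  simp only [bE, spinAt, h _ hε.1, h _ hε.2]

/-- **The surplus field** `c_y(ζ) = ∑_{z ∼ y, z ∉ W'_n} ζ_z - #{z ∼ y : z ∉ Λ_{2n+2}}` of the
internal-spin system with boundary condition `ζ` over the reduced system, at `y ∈ W'_n`
(nonnegative for admissible `ζ`: Step 2 (i)–(ii)). [cite: VanenterFernandezSokal1993, §4.1.2 Step 2 (i)–(ii)] -/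
def surplusField (n : ℕ) (ζ : SpinConfig (Site 2)) (y : Site 2) : ℝ :=
  frozenField (· ∈ internalVolume n) (fun z => spinAt z ζ) y -
    frozenField (· ∈ box 2 (2 * n + 2)) (fun _ => (1 : ℝ)) y

/-- The surplus field of an admissible boundary condition is nonnegative on `W'_n`.
[cite: VanenterFernandezSokal1993, §4.1.2 Step 2 (i)–(ii)] -/
theorem surplusField_nonneg {n : ℕ} {ε : ℤˣ} {ζ : SpinConfig (Site 2)} (hζ : IsAdmissibleBC n ε ζ)
    {y : Site 2} (hy : y ∈ internalVolume n) : 0 ≤ surplusField n ζ y :=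
  sub_nonneg.2 (frozenField_box_le_frozenField hζ hy)

/-- **The tilt factor** `exp(β ∑_{y ∈ W'_n} c_y(ζ) σ_y)` between the internal-spin system with
boundary condition `ζ` and the reduced system. [cite: VanenterFernandezSokal1993, §4.1.2 Step 2] -/
def israelTilt (n : ℕ) (β : ℝ) (ζ : SpinConfig (Site 2)) (σ : SpinConfig (Site 2)) : ℝ :=
  Real.exp (β * ∑ y ∈ internalVolume n, surplusField n ζ y * spinAt y σ)

/-- The tilt factor is positive. [cite: VanenterFernandezSokal1993, §4.1.2 Step 2] -/
theorem israelTilt_pos (n : ℕ) (β : ℝ) (ζ σ : SpinConfig (Site 2)) : 0 < israelTilt n β ζ σ :=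
  Real.exp_pos _

/-- The tilt factor is measurable. [cite: VanenterFernandezSokal1993, §4.1.2 Step 2] -/
theorem measurable_israelTilt (n : ℕ) (β : ℝ) (ζ : SpinConfig (Site 2)) :
    Measurable (israelTilt n β ζ) := by
  unfold israelTilt
  refine Real.measurable_exp.comp (Measurable.const_mul ?_ _)
  exact Finset.measurable_sum _ fun y _ => (measurable_spinAt y).const_mul _

/-- For `β ≥ 0` and an admissible boundary condition the tilt factor is nondecreasing (all surplus
fields are `≥ 0`). [cite: VanenterFernandezSokal1993, §4.1.2 Step 2 (i)–(ii)] -/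
theorem israelTilt_mono {n : ℕ} {β : ℝ} (hβ : 0 ≤ β) {ε : ℤˣ} {ζ : SpinConfig (Site 2)}
    (hζ : IsAdmissibleBC n ε ζ) : Monotone (israelTilt n β ζ) := by
  intro σ σ' hle
  unfold israelTilt
  refine Real.exp_le_exp.2 (mul_le_mul_of_nonneg_left (Finset.sum_le_sum fun y hy => ?_) hβ)
  exact mul_le_mul_of_nonneg_left (spinAt_mono y hle) (surplusField_nonneg hζ hy)

/-- **The weights of an admissible internal-spin system are the tilted weights of the reduced
system**: `w^{ζ}_{W'_n}(τ) = w^{Q_n}(τ) · exp(β ∑_y c_y(ζ) τ_y)`, where `Q_n` is the `+`-boundary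
Ising model on `cutGraph n` — the vertex forms of the two energies
(`sum_edgesTouching_bondSpin_eq`, `sum_edgesTouching_cutGraph_eq`) share the bonds inside `W'_n`
and differ by the fields `∑_{z ∼ y, z ∉ W'} ζ_z` versus `#{z ∼ y : z ∉ Λ_{2n+2}}`.
[cite: VanenterFernandezSokal1993, §4.1.2 Step 2, Figure 4(b)–(c)] -/
theorem isingWeight_admissible_eq_mul_tilt (n : ℕ) (β : ℝ) (ζ : SpinConfig (Site 2))
    (τ : ↥(internalVolume n) → ℤˣ) :
    isingWeight (zdGraph 2) (internalVolume n) β 0 (.fixed ζ) τ =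
      isingWeight (cutGraph n) (internalVolume n) β 0 .plus τ *
        israelTilt n β ζ (glue (internalVolume n) τ .plus) := by
  set σ := glue (internalVolume n) τ (.fixed ζ) with hσ
  set σ' := glue (internalVolume n) τ .plus with hσ'
  have hin : ∀ x ∈ (internalVolume n), σ x = σ' x := fun x hx => by
    rw [hσ, hσ', glue_apply_of_mem _ _ _ hx, glue_apply_of_mem _ _ _ hx]
  -- the two energies in vertex form
  have hP : -isingHamiltonian (zdGraph 2) (internalVolume n) 0 (.fixed ζ) σ =
      ∑ ε ∈ anch (internalVolume n), bE ε σ + ∑ y ∈ (internalVolume n), spinAt y σ *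
        frozenField (· ∈ (internalVolume n)) (fun z => spinAt z ζ) y := by
    simp only [isingHamiltonian, interactionEdges_fixed, zero_mul, sub_zero, neg_neg]
    rw [sum_edgesTouching_bondSpin_eq]
    refine congrArg₂ (· + ·) rfl (Finset.sum_congr rfl fun y _ => ?_)
    refine congrArg₂ (· * ·) rfl (frozenField_congr_fun (fun z hz => ?_) y)
    simp only [spinAt, hσ, glue_apply_of_notMem _ _ _ hz, BoundaryCondition.outside_fixed]
  have hQ : -isingHamiltonian (cutGraph n) (internalVolume n) 0 .plus σ' =
      ∑ ε ∈ anch (internalVolume n), bE ε σ + ∑ y ∈ (internalVolume n), spinAt y σ *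
        frozenField (· ∈ box 2 (2 * n + 2)) (fun _ => (1 : ℝ)) y := by
    have hedges : interactionEdges (cutGraph n) (internalVolume n) .plus =
        edgesTouching (cutGraph n) (internalVolume n) := rfl
    simp only [isingHamiltonian, hedges, zero_mul, sub_zero, neg_neg]
    rw [sum_edgesTouching_cutGraph_eq, sum_anch_bE_congr (internalVolume n) hin]
    refine congrArg₂ (· + ·) rfl (Finset.sum_congr rfl fun y hy => ?_)
    have hsy : spinAt y σ' = spinAt y σ := by simp only [spinAt, hin y hy]
    rw [hsy]
    refine congrArg₂ (· * ·) rfl (frozenField_congr_fun (fun z hz => ?_) y)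
    have hzW : z ∉ (internalVolume n) := fun h => hz (mem_internalVolume_iff.1 h).1
    simp only [spinAt, hσ', glue_apply_of_notMem _ _ _ hzW, plus_outside_apply, Units.val_one,
      Int.cast_one]
  have hspin : ∀ y ∈ (internalVolume n), spinAt y σ' = spinAt y σ := fun y hy => by
    simp only [spinAt, hin y hy]
  have hlast : ∑ y ∈ (internalVolume n), surplusField n ζ y * spinAt y σ' =
      ∑ y ∈ (internalVolume n), surplusField n ζ y * spinAt y σ :=
    Finset.sum_congr rfl fun y hy => by rw [hspin y hy]
  have hexp : -β * isingHamiltonian (zdGraph 2) (internalVolume n) 0 (.fixed ζ) σ =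
      -β * isingHamiltonian (cutGraph n) (internalVolume n) 0 .plus σ' +
        β * ∑ y ∈ (internalVolume n), surplusField n ζ y * spinAt y σ' := by
    have e1 : -β * isingHamiltonian (zdGraph 2) (internalVolume n) 0 (.fixed ζ) σ =
        β * (-isingHamiltonian (zdGraph 2) (internalVolume n) 0 (.fixed ζ) σ) := by ring
    have e2 : -β * isingHamiltonian (cutGraph n) (internalVolume n) 0 .plus σ' =
        β * (-isingHamiltonian (cutGraph n) (internalVolume n) 0 .plus σ') := by ring
    rw [e1, e2, hP, hQ, hlast, ← mul_add, add_assoc, ← Finset.sum_add_distrib]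
    refine congrArg₂ (· * ·) rfl (congrArg₂ (· + ·) rfl (Finset.sum_congr rfl fun y _ => ?_))
    simp only [surplusField]
    ring
  simp only [isingWeight, israelTilt]
  rw [← hσ, ← hσ', ← Real.exp_add, hexp]

/-! ### The comparison theorems -/

/-- **Step 2 of Israel's example, the FKG comparison for nondecreasing observables**: for an
admissible boundary condition `ζ` (image spins `ε ω'_alt` on `Λ_{2n}`, `+` on the annulus,
arbitrary outside), `β ≥ 0`, and a nondecreasing measurable observable `f` of the internal spins,
the expectation in the reduced system (`+`-boundary Ising model on `cutGraph n`: no field inside,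
`+J` on layer `Γ^int_{2n+2}`) is a LOWER bound: `⟨f⟩_{Q_n} ≤ ⟨f⟩^{ζ}_{W'_n}` ("the local
magnetizations … are bounded below by the values that they would take if the magnetic fields
`+2J` in (i) were changed to zero, and the fields `+3J` in (ii) changed to `+J`").
[cite: VanenterFernandezSokal1993, §4.1.2 Step 2] -/
theorem isingExpect_cut_le_admissible {n : ℕ} {β : ℝ} (hβ : 0 ≤ β) {ε : ℤˣ}
    {ζ : SpinConfig (Site 2)} (hζ : IsAdmissibleBC n ε ζ) {f : SpinConfig (Site 2) → ℝ}
    (hf : Monotone f) (hfm : Measurable f)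
    (hfW : ∀ σ σ' : SpinConfig (Site 2), (∀ x ∈ internalVolume n, σ x = σ' x) → f σ = f σ') :
    isingExpect (cutGraph n) (internalVolume n) β 0 .plus f ≤
      isingExpect (zdGraph 2) (internalVolume n) β 0 (.fixed ζ) f :=
  isingExpect_le_of_weight_eq_mul (cutGraph n) (zdGraph 2) hβ (internalVolume n) 0 0 .plus
    (.fixed ζ) (measurable_israelTilt n β ζ) (israelTilt_mono hβ hζ)
    (isingWeight_admissible_eq_mul_tilt n β ζ) hf hfm hfW

/-- **Step 2 of Israel's example, the FKG comparison for nonincreasing observables**: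
`⟨f⟩^{ζ}_{W'_n} ≤ ⟨f⟩_{Q_n}` for nonincreasing local `f` and admissible `ζ`.
[cite: VanenterFernandezSokal1993, §4.1.2 Step 2] -/
theorem isingExpect_admissible_le_cut {n : ℕ} {β : ℝ} (hβ : 0 ≤ β) {ε : ℤˣ}
    {ζ : SpinConfig (Site 2)} (hζ : IsAdmissibleBC n ε ζ) {f : SpinConfig (Site 2) → ℝ}
    (hf : Antitone f) (hfm : Measurable f)
    (hfW : ∀ σ σ' : SpinConfig (Site 2), (∀ x ∈ internalVolume n, σ x = σ' x) → f σ = f σ') :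
    isingExpect (zdGraph 2) (internalVolume n) β 0 (.fixed ζ) f ≤
      isingExpect (cutGraph n) (internalVolume n) β 0 .plus f :=
  isingExpect_ge_of_weight_eq_mul (cutGraph n) (zdGraph 2) hβ (internalVolume n) 0 0 .plus
    (.fixed ζ) (measurable_israelTilt n β ζ) (israelTilt_mono hβ hζ)
    (isingWeight_admissible_eq_mul_tilt n β ζ) hf hfm hfW

end Literature.Barriers.CriticalPhenomena.NonGibbs

end
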